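import Summits.SmoothPoincare4.SmoothPoincare4.Theorems.SymplecticOrigamiContactRepresentative
import Literature.Geometry.Symplectic.ContactIsotopySphereThree
import HarnessLib

/-!
# Route item `ContactRepresentative` (stmt-SmoothPoincare4-14580) closed MODULO the Literature
# named fact `eliashberg_contactRepresentative_sphere_three`

The body of the route item `Summit.SmoothPoincare4.SmoothPoincare4.Theses.SymplecticOrigami.ContactRepresentative`
is, verbatim, the Literature named fact
`Literature.Geometry.Symplectic.eliashberg_contactRepresentative_sphere_three`
(`Literature/Geometry/Symplectic/ContactIsotopySphereThree.lean`; Geiges 2008, Lemma 4.11.1 =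
Eliashberg 1992, Thm 2.1.1 + Gray stability, with the coorientation made positive). This file
records the definitional bridge (`contactRepresentative_iff_eliashberg`, `Iff.rfl`) and the
CONDITIONAL closing theorem `contactRepresentative_of_eliashberg` — the item is closed modulo that
one fact, whose discharge (`…_holds`) is the classification of tight contact structures on `S³`
(XL; no contact topology in Mathlib) — together with the remark that the fact may equivalently be
cited in its unsigned printed form (`eliashberg_iff_factor_ne_zero`, from
`contactRepresentative_iff_factor_ne_zero` of `SymplecticOrigamiContactRepresentative.lean`: the
positive sign is free, by composing with complex conjugation).

## References

* H. Geiges, *An Introduction to Contact Topology*, CUP (2008), Lemma 4.11.1 (p. 229). [Geiges2008]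
* Y. Eliashberg, *Contact 3-manifolds twenty years since J. Martinet's work*, Ann. Inst. Fourier 42
  (1992), Thm 2.1.1. [Eliashberg1992]
-/

-- the prescribed namespace `Summit.<P>.<Sub>.…` duplicates `SmoothPoincare4` (P = Sub)
set_option linter.dupNamespace false

open scoped Manifold ContDiff Topology
open Set Function Metric
open Literature.Topology.FourManifolds Literature.Geometry.Symplectic

noncomputable section

namespace Summit.SmoothPoincare4.SmoothPoincare4.Theorems

/-- **The route item is the Literature named fact, verbatim**: `ContactRepresentative` unfolds by
`Iff.rfl` to `Literature.Geometry.Symplectic.eliashberg_contactRepresentative_sphere_three`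
(Geiges 2008, Lemma 4.11.1). [cite: Geiges2008, Lemma 4.11.1] -/
theorem contactRepresentative_iff_eliashberg :
    Summit.SmoothPoincare4.SmoothPoincare4.Theses.SymplecticOrigami.ContactRepresentative ↔
      eliashberg_contactRepresentative_sphere_three :=
  Iff.rfl

/-- **`ContactRepresentative` closed modulo Eliashberg's contact isotopy on `S³`** (CONDITIONAL on
the Literature named fact `eliashberg_contactRepresentative_sphere_three`; Geiges 2008,
Lemma 4.11.1 = Eliashberg 1992, Thm 2.1.1 with Gray stability): the item follows from the fact by
definitional unfolding, so it closes the day `eliashberg_contactRepresentative_sphere_three_holds`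
lands. [cite: Geiges2008, Lemma 4.11.1] [cite: Eliashberg1992, Thm 2.1.1] -/
theorem contactRepresentative_of_eliashberg (h : eliashberg_contactRepresentative_sphere_three) :
    Summit.SmoothPoincare4.SmoothPoincare4.Theses.SymplecticOrigami.ContactRepresentative :=
  contactRepresentative_iff_eliashberg.mpr h

/-- **The named fact may be cited unsigned.** Eliashberg's contact isotopy on `S³` with POSITIVE
conformal factor (the tree's `eliashberg_contactRepresentative_sphere_three`) is equivalent to the
printed form of Geiges 2008, Lemma 4.11.1 — every orientation-preserving `f ∈ Diff S³` is diffeotopic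
to some `g` with `g^*α₀ = λ α₀`, `λ` smooth and nowhere zero (i.e. `Tg(ξ_st) = ξ_st`) — because the
sign of `λ` is corrected by complex conjugation, an element of `SO(4)` diffeotopic to the identity
with `c^*α₀ = −α₀` (`contactRepresentative_iff_factor_ne_zero`). [cite: Geiges2008, Lemma 4.11.1] -/
theorem eliashberg_iff_factor_ne_zero :
    eliashberg_contactRepresentative_sphere_three ↔
      ∀ (o : SmoothOrientation (𝓡 3) (sphere (0 : EuclideanSpace ℝ (Fin 4)) 1))
        (f : (sphere (0 : EuclideanSpace ℝ (Fin 4)) 1) ≃ₘ⟮𝓡 3, 𝓡 3⟯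
          (sphere (0 : EuclideanSpace ℝ (Fin 4)) 1)),
        f.IsOrientationPreserving o o →
          ∃ (g : (sphere (0 : EuclideanSpace ℝ (Fin 4)) 1) ≃ₘ⟮𝓡 3, 𝓡 3⟯
              (sphere (0 : EuclideanSpace ℝ (Fin 4)) 1)) (l : (sphere (0 : EuclideanSpace ℝ (Fin 4)) 1) → ℝ),
            Diffeomorph.IsDiffeotopic g f ∧ ContMDiff (𝓡 3) 𝓘(ℝ, ℝ) ∞ l ∧ (∀ z, l z ≠ 0) ∧
            ∀ (z : (sphere (0 : EuclideanSpace ℝ (Fin 4)) 1)) (v : TangentSpace (𝓡 3) z),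
              stdSymplecticForm ((g z : (sphere (0 : EuclideanSpace ℝ (Fin 4)) 1)) : EuclideanSpace ℝ (Fin 4))
                  (mfderiv (𝓡 3) 𝓘(ℝ, EuclideanSpace ℝ (Fin 4))
                    (fun w : (sphere (0 : EuclideanSpace ℝ (Fin 4)) 1) =>
                      ((g w : (sphere (0 : EuclideanSpace ℝ (Fin 4)) 1)) : EuclideanSpace ℝ (Fin 4))) z v) =
                l z * stdSymplecticForm ((z : (sphere (0 : EuclideanSpace ℝ (Fin 4)) 1)) : EuclideanSpace ℝ (Fin 4))
                  (mfderiv (𝓡 3) 𝓘(ℝ, EuclideanSpace ℝ (Fin 4))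
                    (fun w : (sphere (0 : EuclideanSpace ℝ (Fin 4)) 1) =>
                      ((w : (sphere (0 : EuclideanSpace ℝ (Fin 4)) 1)) : EuclideanSpace ℝ (Fin 4))) z v) :=
  contactRepresentative_iff_eliashberg.symm.trans contactRepresentative_iff_factor_ne_zero

end Summit.SmoothPoincare4.SmoothPoincare4.Theorems

end
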